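import Literature.AnabelianGeometry.EtaleTheta.LogDivisorTowerRootLaw
import Literature.AnabelianGeometry.EtaleTheta.Discharge.Sec3BLambdaInjectiveOfRlf
import Literature.AnabelianGeometry.EtaleTheta.Discharge.Sec3Thm37ivGenuineBase
import HarnessLib

/-!
# [EtTh] Def. 3.3 (iii) v2 (covering-indexed `Mero`): the pull-backs of `B₀` along covering maps are INJECTIVE for every tower —
# census A9 `hBinj` at `DivisorMonoids.ofTower T` (`Λ = ℤ`, `ℚ`), hence «`C` is a Frobenioid» over the genuine base

S. Mochizuki, *The étale theta function and its Frobenioid-theoretic manifestations*, Publ. RIMS **45** (2009), Def. 3.3 (iii)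
pp.73–74 («by (i), (c), the assignments … determine functors `Φ₀, B₀ : D₀ → Mon`»; `B₀(Y) → B₀(Y')` = pull-back of log-meromorphic
functions along a dominant covering), Def. 3.6 (i)(ii) pp.76–77 [cite: MochizukiEtTh2009, Def 3.3 (iii) p.74]; S. Mochizuki, *The
geometry of Frobenioids I* (2008), Thm. 5.2 (i)–(ii) p.100 («`𝔹` a monoid on `D`»; the model Frobenioid is a Frobenioid)
[cite: MochizukiFrdI2008, Thm. 5.2 (ii) p.100].

abc-iut cell, layer L2, seat abc-iut-L2-d2 (gen 5); abc-iut-L2-lead **R587 (b)** «hBinj at `ofTower`» (memo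
`VNEXT-V2-RealifiedChain-L2d2.md` §1, row A9).  PROOF-ONLY, generic over ANY v2 tower `T : LogDivisorTower Π L` of abc-iut-L2-t3
(`LogDivisorTower.lean`):

* `LogDivisorTower.ofTower_B₀_map_injective` — `(ofTower T).B₀(f) = transB ∘ bZeroPull f` is injective: the pull-back along a map
  of CONNECTED tempered coverings is injective (such a map is surjective, [FrdII] Ex. 1.3; abc-iut-w6-d058's `bZeroPull_injective`)
  and the level change `transB` is injective (`transB_injective`, from the tower's `resFn_injective`);
* `ofTower_ofRlfZWeak_hBinj`, `ofTower_ofRlfQWeak_hBinj` — census A9 `hBinj` at the weak Def. 3.6 (i) data `Λ = ℤ` / `ℚ` over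
  `ofTower T` (abc-iut-L2-t3's `ofRlfZWeak_hBinj` / `ofRlfQWeak_hBinj`); the `Λ = ℝ` form needs `Φ₀(f)` to reflect divisibility
  (`ofRlfRWeak_hBinj_of_reflects`), a per-tower property, and is not claimed;
* consequences BY NAME for EVERY tempered Frobenioid over these data re-based to print's genuine base `B^temp(Π′)⁰`
  (abc-iut-w5-d179's `isFrobenioid_connectedPart_bTemp`, `isMonoidOn_ratFnFunctor_connectedPart_bTemp`):
  `TemperedFrobenioid.isMonoidOn_ratFnFunctor_ofTower_connectedPart`, `TemperedFrobenioid.isFrobenioid_ofTower_connectedPart`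
  («`C` is a Frobenioid», [FrdI] Thm. 5.2 (ii), with NO binder) — `Λ = ℤ` and `ℚ`.

HONEST LABEL: structural facts about the v2 interface; nothing here bears on [IUTchIII] Cor. 3.12; no side taken; typed ≠ proved.
-/

noncomputable section

namespace Literature.AnabelianGeometry.EtaleTheta

open CategoryTheory Opposite Function Literature.AlgebraicGeometry.Frobenioids Literature.AnabelianGeometry.SemiGraphs
  LogDivisorModel LogDivisorModel.GaloisAction

universe u

namespace LogDivisorTower

variable {P : Type u} [Group P] [TopologicalSpace P] {L : LevelSystem P} (T : LogDivisorTower P L)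

/-- A map of CONNECTED tempered coverings is surjective on points ([FrdII] Ex. 1.3: one orbit maps onto one orbit).
[cite: MochizukiFrdII2008, Ex 1.3 (ii) p.11] -/
theorem hom_surjective_connectedPart {Y' Y : ConnectedPart (BTemp P)} (f : Y' ⟶ Y) : Surjective f.hom.hom.hom := fun y =>
  QuasiTemperoid.BTempConnected.surjective_of_isConnectedObj
    (QuasiTemperoid.BTempConnected.nonempty_of_isConnectedObj Y'.obj Y'.property).some Y.property f.hom y

/-- **The pull-backs of `B₀` are injective for every v2 tower**: `(ofTower T).B₀(f) = transB ∘ bZeroPull f` with both factors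
injective (dominant covering; injective level change). [cite: MochizukiEtTh2009, Def 3.3 (iii) p.74] -/
theorem ofTower_B₀_map_injective {Y Y' : (ConnectedPart (BTemp P))ᵒᵖ} (f : Y ⟶ Y') :
    Injective ((DivisorMonoids.ofTower T).B₀.map f).hom := fun _ _ hbc =>
  (T.act (L.lvl Y.unop)).bZeroPull_injective f.unop.hom.hom (hom_surjective_connectedPart f.unop)
    (T.transB_injective (L.closure_lvl_mono f.unop) (gset Y'.unop) hbc)

/-- **Census A9 `hBinj` at the weak Def. 3.6 (i) data `Λ = ℤ` over `ofTower T`** (`B₀^ℤ = B₀`). [cite: MochizukiEtTh2009, Def 3.6 p.76] -/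
theorem ofTower_ofRlfZWeak_hBinj
    (hpf : ∀ Y : (ConnectedPart (BTemp P))ᵒᵖ, IsPerfFactorialCof ((DivisorMonoids.ofTower T).Φ₀.obj Y)) :
    ∀ {Y Y' : (ConnectedPart (BTemp P))ᵒᵖ} (g : Y ⟶ Y'),
      Injective ((RealifiedDivisorMonoids.ofRlfZWeak (DivisorMonoids.ofTower T) hpf).BΛ.map g).hom :=
  RealifiedDivisorMonoids.ofRlfZWeak_hBinj (DivisorMonoids.ofTower T) hpf fun g => T.ofTower_B₀_map_injective g

/-- **Census A9 `hBinj` at the weak Def. 3.6 (i) data `Λ = ℚ` over `ofTower T`** (`B₀^ℚ = B₀^pf`). [cite: MochizukiEtTh2009, Def 3.6 p.76] -/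
theorem ofTower_ofRlfQWeak_hBinj
    (hpf : ∀ Y : (ConnectedPart (BTemp P))ᵒᵖ, IsPerfFactorialCof ((DivisorMonoids.ofTower T).Φ₀.obj Y)) :
    ∀ {Y Y' : (ConnectedPart (BTemp P))ᵒᵖ} (g : Y ⟶ Y'),
      Injective ((RealifiedDivisorMonoids.ofRlfQWeak (DivisorMonoids.ofTower T) hpf).BΛ.map g).hom :=
  RealifiedDivisorMonoids.ofRlfQWeak_hBinj (DivisorMonoids.ofTower T) hpf fun g => T.ofTower_B₀_map_injective g

end LogDivisorTower

/-! ### Consequences for tempered Frobenioids over the v2 data, re-based to the genuine base `B^temp(Π′)⁰` -/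

namespace TemperedFrobenioid

variable {P : Type u} [Group P] [TopologicalSpace P] {L : LevelSystem P} (T : LogDivisorTower P L)
  (hpf : ∀ Y : (ConnectedPart (BTemp P))ᵒᵖ, IsPerfFactorialCof ((DivisorMonoids.ofTower T).Φ₀.obj Y))
  {G : Type u} [Group G] [TopologicalSpace G]
  {IsRational IsStrictlyRational : ((ConnectedPart (BTemp G))ᵒᵖ ⥤ CommMonCat.{u}) → Prop}

/-- **`hBmon` («`𝔹` is a monoid on `D`», [FrdI] Thm. 5.2 preamble) with NO binder** for every tempered Frobenioid over the weak
`Λ = ℤ` data of a v2 tower, re-based to `B^temp(Π′)⁰`. [cite: MochizukiFrdI2008, Thm. 5.2 p.100] -/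
theorem isMonoidOn_ratFnFunctor_ofTower_connectedPart
    (C₀ : TemperedFrobenioid (RealifiedDivisorMonoids.ofRlfZWeak (DivisorMonoids.ofTower T) hpf) (ConnectedPart (BTemp G))
      (treeCatVocab (ConnectedPart (BTemp G)) IsRational IsStrictlyRational)) :
    IsMonoidOn C₀.ratFnFunctor :=
  C₀.isMonoidOn_ratFnFunctor_connectedPart_bTemp (T.ofTower_ofRlfZWeak_hBinj hpf)

/-- **«`C` is a Frobenioid» ([FrdI] Thm. 5.2 (ii)) with NO binder** for every tempered Frobenioid over the weak `Λ = ℤ` data of a v2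
tower, re-based to `B^temp(Π′)⁰`. [cite: MochizukiFrdI2008, Thm. 5.2 (ii) p.100] -/
theorem isFrobenioid_ofTower_connectedPart
    (C₀ : TemperedFrobenioid (RealifiedDivisorMonoids.ofRlfZWeak (DivisorMonoids.ofTower T) hpf) (ConnectedPart (BTemp G))
      (treeCatVocab (ConnectedPart (BTemp G)) IsRational IsStrictlyRational)) :
    PreFrobenioid.IsFrobenioid C₀.toElem :=
  C₀.isFrobenioid_connectedPart_bTemp (T.ofTower_ofRlfZWeak_hBinj hpf)

/-- The same two facts at `Λ = ℚ`. [cite: MochizukiFrdI2008, Thm. 5.2 (ii) p.100] -/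
theorem isFrobenioid_ofTower_connectedPart_Q
    (C₀ : TemperedFrobenioid (RealifiedDivisorMonoids.ofRlfQWeak (DivisorMonoids.ofTower T) hpf) (ConnectedPart (BTemp G))
      (treeCatVocab (ConnectedPart (BTemp G)) IsRational IsStrictlyRational)) :
    IsMonoidOn C₀.ratFnFunctor ∧ PreFrobenioid.IsFrobenioid C₀.toElem :=
  ⟨C₀.isMonoidOn_ratFnFunctor_connectedPart_bTemp (T.ofTower_ofRlfQWeak_hBinj hpf),
    C₀.isFrobenioid_connectedPart_bTemp (T.ofTower_ofRlfQWeak_hBinj hpf)⟩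

end TemperedFrobenioid

end Literature.AnabelianGeometry.EtaleTheta

end
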